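import Mathlib.Analysis.SpecialFunctions.ImproperIntegrals
import Mathlib.Analysis.SpecialFunctions.Integrability.Basic
import Mathlib.MeasureTheory.Integral.Pi
import Mathlib.Topology.Algebra.MvPolynomial
import Literature.MathematicalPhysics.QuantumFieldTheory.GraphPeriodHeppBound
import HarnessLib

/-!
# Convergence of the parametric period integral of a primitive-divergent graph — proofs

Topic `MathematicalPhysics/QuantumFieldTheory`. Discharges the named fact
`Literature.MathematicalPhysics.QuantumFieldTheory.graphPeriod_convergent_of_isPrimitiveDivergent`
of `GraphPeriod.lean` (Brown 2009, §3.1 after Bloch–Esnault–Kreimer 2006, Prop. 5.2: for a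
connected primitive-divergent graph `Ψ > 0` on the open simplex and `∫ Ω/Ψ²` converges absolutely),
as `graphPeriod_convergent_of_isPrimitiveDivergent_holds`.

## Proof (Hepp-sector power counting, made affine)

1. `heppBound` (`GraphPeriodHeppBound.lean` supplies the algebra): for positive weights `y` on the
   `N` edges of a connected primitive-divergent edge list, `(Π_e y_e) · y_j ≤ Ψ(y)² · y_i` for all
   `i, j`, and `Ψ(y) > 0`. Sort the edges by weight (`Tuple.sort`; `Ψ`, connectedness and primitive
   divergence are invariant under relabeling, `kirchhoffEval_comp_perm` & co.), let `T` be the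
   greedy (Kruskal) row basis of the incidence rows in this order: `Ψ(y) ≥ Π_{e∉T} y_e`
   (`prod_compl_le_kirchhoffEval`), and `#(T ∩ first m edges) = rk` so that primitive divergence
   `2 h(γ_m) < m` makes every proper prefix sum of the signs `c_e = ±1` (`-1` on `T`) at most `-1`,
   with total `N - 2V = 0`; Abel summation (`hepp_abel_ineq`) gives
   `Π_{e∉T} y_e / Π_{e∈T} y_e ≥ y_max / y_min`.
2. In the chart `y = (x, 1)`: `1/Ψ(x,1)² · Π_i x_i ≤ min(x_i, 1/x_i)` for each `i`, hence (geometric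
   mean) `1/Ψ(x,1)² ≤ Π_i x_i⁻¹ min(x_i, x_i⁻¹)^{1/n}`, a product of functions integrable on `(0,∞)`
   (`t^{1/n-1}` near `0`, `t^{-1-1/n}` at `∞`); `Integrable.fintype_prod` and domination finish.

This replaces BEK's blow-up of momentum-space quadrics (their Lemma 5.1) by the folklore sector
estimate; the statement discharged is exactly the vendored one.

## References

* [Brown2009FeynmanPeriods] F. Brown, arXiv:0910.0114, §3.1 (convergence and positivity of `I_G`),
  Prop. 21.
* [BlochEsnaultKreimer2006] S. Bloch, H. Esnault, D. Kreimer, CMP 267 (2006), Lemma 5.1, Prop. 5.2.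
-/

noncomputable section

open Matrix Finset MeasureTheory

namespace Literature.MathematicalPhysics.QuantumFieldTheory

variable {N V : ℕ}

/-! ### Relabeling the edges -/

section Relabel

variable (E : Fin N → Fin (V + 1) × Fin (V + 1)) (σ : Equiv.Perm (Fin N))

/-- The Kirchhoff determinant is invariant under relabeling the edges (simultaneous permutation of
the edge rows/columns of the graph matrix). [folklore] -/
theorem kirchhoffEval_comp_perm {R : Type*} [CommRing R] (x : Fin N → R) :
    kirchhoffEval (E ∘ σ) (x ∘ σ) = kirchhoffEval E x := by
  have hI : reducedIncidence R (E ∘ σ) = (reducedIncidence R E).submatrix σ id := rfl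
  have h : graphMatrix (E ∘ σ) (x ∘ σ) = (graphMatrix E x).submatrix
      (Equiv.sumCongr σ (Equiv.refl (Fin V))) (Equiv.sumCongr σ (Equiv.refl (Fin V))) := by
    ext (e | j) (e' | j') <;> simp [graphMatrix, hI, Matrix.diagonal_apply]
  rw [kirchhoffEval, kirchhoffEval, h]
  exact det_submatrix_equiv_self _ _

/-- The rank of a set of edge rows is invariant under relabeling. [folklore] -/
theorem edgeRank_comp_perm (γ : Finset (Fin N)) :
    edgeRank (E ∘ σ) γ = edgeRank E (γ.map σ.toEmbedding) := by
  unfold edgeRank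
  let e : {x // x ∈ γ} ≃ {x // x ∈ γ.map σ.toEmbedding} :=
    σ.subtypeEquiv fun a => by simp
  have h : (Matrix.of fun (p : {x // x ∈ γ}) (j : Fin V) => reducedIncidence ℚ (E ∘ σ) p.1 j) =
      (Matrix.of fun (q : {x // x ∈ γ.map σ.toEmbedding}) (j : Fin V) =>
        reducedIncidence ℚ E q.1 j).submatrix e (Equiv.refl (Fin V)) := by
    ext p j
    rfl
  rw [h, rank_submatrix]

/-- The loop number of a set of edges is invariant under relabeling. [folklore] -/
theorem loopNumber_comp_perm (γ : Finset (Fin N)) :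
    loopNumber (E ∘ σ) γ = loopNumber E (γ.map σ.toEmbedding) := by
  rw [loopNumber, loopNumber, edgeRank_comp_perm, Finset.card_map]

/-- Connectedness is invariant under relabeling. [folklore] -/
theorem isConnectedEdgeList_comp_perm (h : IsConnectedEdgeList E) :
    IsConnectedEdgeList (E ∘ σ) := by
  unfold IsConnectedEdgeList at h ⊢
  have : reducedIncidence ℚ (E ∘ σ) = (reducedIncidence ℚ E).submatrix σ (Equiv.refl (Fin V)) := rfl
  rw [this, rank_submatrix, h]

/-- Primitive divergence is invariant under relabeling. [folklore] -/
theorem isPrimitiveDivergent_comp_perm (h : IsPrimitiveDivergent E) :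
    IsPrimitiveDivergent (E ∘ σ) := by
  obtain ⟨h1, h2⟩ := h
  refine ⟨?_, fun γ hne hnu => ?_⟩
  · rw [loopNumber_comp_perm, Finset.map_univ_equiv]
    exact h1
  · rw [loopNumber_comp_perm]
    have hne' : (γ.map σ.toEmbedding).Nonempty := hne.map
    have hnu' : γ.map σ.toEmbedding ≠ univ := by
      intro hu
      apply hnu
      apply Finset.eq_univ_of_card
      rw [← Finset.card_map σ.toEmbedding, hu, Finset.card_univ]
    simpa [Finset.card_map] using h2 _ hne' hnu'

end Relabel

/-! ### The Hepp bound -/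

section Hepp

variable (E : Fin N → Fin (V + 1) × Fin (V + 1))

/-- The rank of a set of edge rows is the dimension of the span of those rows. [folklore] -/
theorem edgeRank_eq_finrank_span (γ : Finset (Fin N)) :
    edgeRank E γ = Module.finrank ℚ
      (Submodule.span ℚ ((fun e => reducedIncidence ℚ E e) '' ↑γ)) := by
  rw [edgeRank, rank_eq_finrank_span_row, Set.image_eq_range]
  rfl

/-- The rank of all edge rows is the rank of the reduced incidence matrix. [folklore] -/
theorem edgeRank_univ : edgeRank E univ = (reducedIncidence ℚ E).rank := by
  unfold edgeRank
  have h : (Matrix.of fun (p : {x // x ∈ (univ : Finset (Fin N))}) (j : Fin V) =>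
      reducedIncidence ℚ E p.1 j) = (reducedIncidence ℚ E).submatrix
        (Equiv.subtypeUnivEquiv (fun x => Finset.mem_univ x)) (Equiv.refl (Fin V)) := by
    ext p j
    rfl
  rw [h, rank_submatrix]

/-- The rank of a set of edge rows is at most its size. [folklore] -/
theorem edgeRank_le_card (γ : Finset (Fin N)) : edgeRank E γ ≤ γ.card := by
  unfold edgeRank
  refine (rank_le_card_height _).trans ?_
  simp

/-- **Hepp bound, sorted case.** For a connected primitive-divergent edge list and positive,
monotonically labelled weights `y₀ ≤ y₁ ≤ ⋯`, `(Π_e y_e) · y_j ≤ Ψ_E(y)² · y_i` for all `i, j`, and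
`0 < Ψ_E(y)`. [folklore] -/
theorem heppBound_sorted (hc : IsConnectedEdgeList E) (hp : IsPrimitiveDivergent E)
    (y : Fin N → ℝ) (hy : ∀ e, 0 < y e) (hmono : Monotone y) (i j : Fin N) :
    (∏ e, y e) * y j ≤ kirchhoffEval E y ^ 2 * y i ∧ 0 < kirchhoffEval E y := by
  classical
  -- the greedy row basis `T` and its rank counts
  set v : Fin N → (Fin V → ℚ) := fun e => reducedIncidence ℚ E e with hv
  obtain ⟨T, hli, hTcount⟩ := exists_greedyRows ℚ v
  have hcount : ∀ m, (T ∩ univ.filter fun k : Fin N => (k : ℕ) < m).card =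
      edgeRank E (univ.filter fun k : Fin N => (k : ℕ) < m) := fun m => by
    rw [hTcount, edgeRank_eq_finrank_span]
  have hc' : (reducedIncidence ℚ E).rank = V := hc
  have hV : V ≤ N := by
    have := rank_le_card_height (reducedIncidence ℚ E)
    simpa [hc'] using this
  have hTcard : T.card = V := by
    have := hcount N
    rwa [ltFilter_of_le le_rfl, Finset.inter_univ, edgeRank_univ, hc'] at this
  -- `N = 2V` from `N = 2 h(E)`
  have hN2V : N = 2 * V := by
    have h1 := hp.1
    rw [loopNumber, Finset.card_univ, Fintype.card_fin, edgeRank_univ, hc'] at h1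
    omega
  -- enumerate `T` increasingly; its rows are independent, so the integer minor is non-zero
  set t : Fin V ↪o Fin N := T.orderEmbOfFin hTcard with ht
  have htT : univ.image (t : Fin V → Fin N) = T := by
    rw [ht]; exact Finset.image_orderEmbOfFin_univ T hTcard
  have hdetQ : ((reducedIncidence ℚ E).submatrix t id).det ≠ 0 := by
    have hrows : LinearIndependent ℚ ((reducedIncidence ℚ E).submatrix t id).row := by
      have hinj : Function.Injective (fun k : Fin V => (⟨t k, by
          rw [← Finset.mem_coe, ← htT]; simp⟩ : {x // x ∈ T})) :=
        fun k l hkl => t.injective (congrArg Subtype.val hkl)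
      exact hli.linearIndependent.comp _ hinj
    have hunit := Matrix.linearIndependent_rows_iff_isUnit.mp hrows
    exact ((Matrix.isUnit_iff_isUnit_det _).mp hunit).ne_zero
  have hdetZ : ((reducedIncidence ℤ E).submatrix t id).det ≠ 0 := by
    intro h0
    apply hdetQ
    have hmap : (reducedIncidence ℚ E).submatrix t id =
        ((reducedIncidence ℤ E).submatrix t id).map (Int.castRingHom ℚ) := by
      rw [← Matrix.submatrix_map, reducedIncidence_map]
    rw [hmap, ← RingHom.mapMatrix_apply, ← RingHom.map_det, h0, map_zero]
  -- the one-tree lower bound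
  obtain ⟨hlow, hpos⟩ := prod_compl_le_kirchhoffEval E y hy t.strictMono hdetZ
  rw [htT] at hlow
  refine ⟨?_, hpos⟩
  -- Abel summation with the signs `c = -1` on `T`, `+1` off `T`
  set c : Fin N → ℝ := fun e => if e ∈ T then -1 else 1 with hcdef
  have hcsum : ∀ s : Finset (Fin N),
      ∑ e ∈ s, c e = ((s \ T).card : ℝ) - ((s ∩ T).card : ℝ) := by
    intro s
    rw [← Finset.sum_filter_add_sum_filter_not s (fun e => e ∈ T) c]
    have h1 : ∑ e ∈ s.filter (fun e => e ∈ T), c e = ∑ e ∈ s.filter (fun e => e ∈ T), (-1 : ℝ) :=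
      Finset.sum_congr rfl fun e he => by
        rw [Finset.mem_filter] at he
        simp [hcdef, he.2]
    have h2 : ∑ e ∈ s.filter (fun e => e ∉ T), c e = ∑ e ∈ s.filter (fun e => e ∉ T), (1 : ℝ) :=
      Finset.sum_congr rfl fun e he => by
        rw [Finset.mem_filter] at he
        simp [hcdef, he.2]
    rw [h1, h2, Finset.sum_const, Finset.sum_const, Finset.filter_mem_eq_inter, Finset.filter_not,
      Finset.filter_mem_eq_inter, Finset.sdiff_inter_self_left]
    simp only [nsmul_eq_mul, mul_neg, mul_one]
    ring
  have hS : ∀ m, 0 < m → m < N → ∑ e ∈ univ.filter (fun k : Fin N => (k : ℕ) < m), c e ≤ -1 := by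
    intro m hm0 hmN
    set γ : Finset (Fin N) := univ.filter (fun k : Fin N => (k : ℕ) < m) with hγ
    rw [hcsum]
    have hcard : γ.card = m := card_ltFilter hmN.le
    have hsplit := Finset.card_sdiff_add_card_inter γ T
    have hr : (γ ∩ T).card = edgeRank E γ := by rw [Finset.inter_comm]; exact hcount m
    have hrle : edgeRank E γ ≤ m := (edgeRank_le_card E _).trans hcard.le
    have hne : γ.Nonempty := Finset.card_pos.mp (by omega)
    have hnu : γ ≠ univ := by
      intro hu
      have := congrArg Finset.card hu
      rw [hcard, Finset.card_univ, Fintype.card_fin] at this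
      omega
    have hpd := hp.2 _ hne hnu
    rw [loopNumber, hcard] at hpd
    have h1 : (γ \ T).card + 1 ≤ (γ ∩ T).card := by omega
    have h2 : ((γ \ T).card : ℝ) + 1 ≤ ((γ ∩ T).card : ℝ) := by exact_mod_cast h1
    linarith
  have hSN : ∑ e, c e = 0 := by
    rw [hcsum, Finset.card_univ_sdiff, Finset.univ_inter, hTcard, Fintype.card_fin, Nat.cast_sub hV]
    have : (N : ℝ) = 2 * V := by exact_mod_cast hN2V
    linarith
  have habel := hepp_abel_ineq (fun e => Real.log (y e)) c
    (fun a b hab => Real.log_le_log (hy a) (hmono hab)) hS hSN i j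
  have hsumlog : ∑ e, c e * Real.log (y e) =
      Real.log (∏ e ∈ Tᶜ, y e) - Real.log (∏ e ∈ T, y e) := by
    rw [Real.log_prod (fun e _ => (hy e).ne'), Real.log_prod (fun e _ => (hy e).ne'),
      ← Finset.sum_add_sum_compl T (fun e => c e * Real.log (y e))]
    have h1 : ∑ e ∈ Tᶜ, c e * Real.log (y e) = ∑ e ∈ Tᶜ, Real.log (y e) :=
      Finset.sum_congr rfl fun e he => by
        rw [Finset.mem_compl] at he
        simp [hcdef, he]
    have h2 : ∑ e ∈ T, c e * Real.log (y e) = ∑ e ∈ T, -Real.log (y e) :=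
      Finset.sum_congr rfl fun e he => by simp [hcdef, he]
    rw [h1, h2, Finset.sum_neg_distrib]
    ring
  set P := ∏ e ∈ Tᶜ, y e with hP
  set Q := ∏ e ∈ T, y e with hQ
  have hP0 : 0 < P := prod_pos fun e _ => hy e
  have hQ0 : 0 < Q := prod_pos fun e _ => hy e
  have hmain : y j * Q ≤ y i * P := by
    have hlog : Real.log (y j * Q) ≤ Real.log (y i * P) := by
      rw [Real.log_mul (hy j).ne' hQ0.ne', Real.log_mul (hy i).ne' hP0.ne']
      linarith [habel, hsumlog]
    exact (Real.log_le_log_iff (mul_pos (hy j) hQ0) (mul_pos (hy i) hP0)).mp hlog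
  have hprod : ∏ e, y e = Q * P := (Finset.prod_mul_prod_compl T y).symm
  have hPf : P ^ 2 ≤ kirchhoffEval E y ^ 2 := pow_le_pow_left₀ hP0.le hlow 2
  calc (∏ e, y e) * y j = P * (y j * Q) := by rw [hprod]; ring
    _ ≤ P * (y i * P) := mul_le_mul_of_nonneg_left hmain hP0.le
    _ = P ^ 2 * y i := by ring
    _ ≤ kirchhoffEval E y ^ 2 * y i := mul_le_mul_of_nonneg_right hPf (hy i).le

/-- **Hepp bound.** For a connected primitive-divergent edge list `E` with `N` edges and positive
weights `y`, `(Π_e y_e) · y_j ≤ Ψ_E(y)² · y_i` for all edges `i, j`, and `0 < Ψ_E(y)`: sort the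
weights and apply `heppBound_sorted` to the relabelled edge list. (In Hepp-sector language:
`Ψ_E ≥ Π_k t_k^{h(γ_k)}` and primitive divergence `|γ_k| ≥ 2h(γ_k) + 1`.) [folklore] -/
theorem heppBound (hc : IsConnectedEdgeList E) (hp : IsPrimitiveDivergent E)
    (y : Fin N → ℝ) (hy : ∀ e, 0 < y e) (i j : Fin N) :
    (∏ e, y e) * y j ≤ kirchhoffEval E y ^ 2 * y i ∧ 0 < kirchhoffEval E y := by
  set σ : Equiv.Perm (Fin N) := Tuple.sort y with hσ
  have hmono : Monotone (y ∘ σ) := Tuple.monotone_sort y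
  obtain ⟨h, hpos⟩ := heppBound_sorted (E ∘ σ) (isConnectedEdgeList_comp_perm E σ hc)
    (isPrimitiveDivergent_comp_perm E σ hp) (y ∘ σ) (fun e => hy _) hmono (σ.symm i) (σ.symm j)
  rw [kirchhoffEval_comp_perm] at h hpos
  refine ⟨?_, hpos⟩
  simpa [Function.comp_apply, Equiv.apply_symm_apply, Equiv.prod_comp σ y] using h

end Hepp

/-! ### Integrability in the affine chart and the discharge -/

section Integrability

/-- The one-variable majorant `g_δ(t) = t⁻¹ · min(t, t⁻¹)^δ` (`= t^{δ-1}` on `(0,1]`, `t^{-1-δ}` on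
`[1,∞)`) is integrable on `(0, ∞)` for `δ > 0`. [folklore] -/
theorem integrableOn_heppMajorant {δ : ℝ} (hδ : 0 < δ) :
    IntegrableOn (fun t : ℝ => t⁻¹ * (min t t⁻¹) ^ δ) (Set.Ioi 0) := by
  have h1 : IntegrableOn (fun t : ℝ => t⁻¹ * (min t t⁻¹) ^ δ) (Set.Ioc 0 1) := by
    have hint : IntegrableOn (fun t : ℝ => t ^ (δ - 1)) (Set.Ioo 0 1) :=
      (intervalIntegral.integrableOn_Ioo_rpow_iff one_pos).mpr (by linarith)
    rw [← integrableOn_Ioc_iff_integrableOn_Ioo] at hint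
    refine hint.congr_fun (fun t ht => ?_) measurableSet_Ioc
    have ht0 : 0 < t := ht.1
    have hmin : min t t⁻¹ = t := min_eq_left (ht.2.trans (one_le_inv_iff₀.mpr ⟨ht0, ht.2⟩))
    show t ^ (δ - 1) = t⁻¹ * (min t t⁻¹) ^ δ
    rw [hmin, Real.rpow_sub_one ht0.ne', div_eq_inv_mul]
  have h2 : IntegrableOn (fun t : ℝ => t⁻¹ * (min t t⁻¹) ^ δ) (Set.Ioi 1) := by
    have hint : IntegrableOn (fun t : ℝ => t ^ (-δ - 1)) (Set.Ioi 1) :=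
      integrableOn_Ioi_rpow_of_lt (by linarith) one_pos
    refine hint.congr_fun (fun t ht => ?_) measurableSet_Ioi
    have ht1 : 1 < t := ht
    have ht0 : 0 < t := one_pos.trans ht1
    have hmin : min t t⁻¹ = t⁻¹ := min_eq_right ((inv_le_one_of_one_le₀ ht1.le).trans ht1.le)
    show t ^ (-δ - 1) = t⁻¹ * (min t t⁻¹) ^ δ
    rw [hmin, Real.inv_rpow ht0.le, ← Real.rpow_neg ht0.le,
      Real.rpow_sub_one ht0.ne', div_eq_inv_mul]
  have h12 := h1.union h2
  rwa [Set.Ioc_union_Ioi_eq_Ioi zero_le_one] at h12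

/-- The last-coordinate-`1` extension of a point of the open orthant is positive. [folklore] -/
theorem snoc_pos {n : ℕ} {x : Fin n → ℝ} (hx : x ∈ openOrthant n) (e : Fin (n + 1)) :
    0 < (Fin.snoc x (1 : ℝ) : Fin (n + 1) → ℝ) e := by
  refine Fin.lastCases ?_ (fun i => ?_) e
  · simp
  · simpa using hx i

/-- **Pointwise domination** of the period integrand of a connected primitive-divergent edge list by
the product majorant: `1/Ψ_E(x,1)² ≤ Π_k x_k⁻¹ min(x_k, x_k⁻¹)^{1/n}` on the open orthant.
[folklore] -/
theorem graphPeriodIntegrand_le_prod_heppMajorant {n : ℕ} (hn : n ≠ 0)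
    (E : Fin (n + 1) → Fin (V + 1) × Fin (V + 1)) (hc : IsConnectedEdgeList E)
    (hp : IsPrimitiveDivergent E) (x : Fin n → ℝ) (hx : x ∈ openOrthant n) :
    graphPeriodIntegrand E x ≤ ∏ k, ((x k)⁻¹ * (min (x k) (x k)⁻¹) ^ ((n : ℝ)⁻¹)) := by
  set y : Fin (n + 1) → ℝ := Fin.snoc x 1 with hydef
  have hy : ∀ e, 0 < y e := snoc_pos hx
  set f := kirchhoffEval E y with hf
  have hfpos : 0 < f := (heppBound E hc hp y hy 0 0).2
  set P := ∏ k, x k with hP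
  have hP0 : 0 < P := prod_pos fun k _ => hx k
  have hprodY : ∏ e, y e = P := by rw [hydef, Fin.prod_snoc, mul_one]
  set u := P / f ^ 2 with hu
  have hu0 : 0 ≤ u := div_nonneg hP0.le (sq_nonneg _)
  have hux : ∀ k, u ≤ min (x k) (x k)⁻¹ := by
    intro k
    have h1 := (heppBound E hc hp y hy (Fin.last n) (Fin.castSucc k)).1
    have h2 := (heppBound E hc hp y hy (Fin.castSucc k) (Fin.last n)).1
    rw [hprodY] at h1 h2
    simp only [hydef, Fin.snoc_last, Fin.snoc_castSucc, mul_one] at h1 h2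
    refine le_min ?_ ?_
    · rw [hu, div_le_iff₀ (pow_pos hfpos 2)]
      linarith
    · rw [hu, div_le_iff₀ (pow_pos hfpos 2), inv_mul_eq_div, le_div_iff₀ (hx k)]
      linarith
  have hmin0 : ∀ k, 0 ≤ min (x k) (x k)⁻¹ := fun k => le_min (hx k).le (inv_nonneg.mpr (hx k).le)
  have hun : u ^ n ≤ ∏ k, min (x k) (x k)⁻¹ := by
    calc u ^ n = ∏ _k : Fin n, u := by simp
      _ ≤ ∏ k, min (x k) (x k)⁻¹ := Finset.prod_le_prod (fun _ _ => hu0) fun k _ => hux k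
  have hule : u ≤ ∏ k, (min (x k) (x k)⁻¹) ^ ((n : ℝ)⁻¹) := by
    have h := Real.rpow_le_rpow (pow_nonneg hu0 n) hun (inv_nonneg.mpr (Nat.cast_nonneg n))
    rw [Real.pow_rpow_inv_natCast hu0 hn] at h
    rwa [Real.finsetProd_rpow _ _ (fun k _ => hmin0 k)]
  have hF : graphPeriodIntegrand E x = u * ∏ k, (x k)⁻¹ := by
    rw [Finset.prod_inv_distrib, ← hP, hu]
    show 1 / f ^ 2 = P / f ^ 2 * P⁻¹
    field_simp
  rw [hF]
  calc u * ∏ k, (x k)⁻¹ ≤ (∏ k, (min (x k) (x k)⁻¹) ^ ((n : ℝ)⁻¹)) * ∏ k, (x k)⁻¹ :=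
      mul_le_mul_of_nonneg_right hule (prod_nonneg fun k _ => inv_nonneg.mpr (hx k).le)
    _ = ∏ k, ((x k)⁻¹ * (min (x k) (x k)⁻¹) ^ ((n : ℝ)⁻¹)) := by
      rw [← Finset.prod_mul_distrib]
      exact Finset.prod_congr rfl fun k _ => mul_comm _ _

/-- The period integrand is measurable (a rational function of the coordinates). [folklore] -/
theorem measurable_graphPeriodIntegrand {n : ℕ} (E : Fin (n + 1) → Fin (V + 1) × Fin (V + 1)) :
    Measurable (graphPeriodIntegrand E) := by
  have hcont : Continuous fun x : Fin n → ℝ =>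
      kirchhoffEval E (Fin.snoc x (1 : ℝ) : Fin (n + 1) → ℝ) := by
    have h1 : Continuous fun y : Fin (n + 1) → ℝ => kirchhoffEval E y := by
      have heq : (fun y : Fin (n + 1) → ℝ => kirchhoffEval E y) =
          fun y => MvPolynomial.eval y (kirchhoffPolynomial ℝ E) := by
        funext y
        rw [← aeval_kirchhoffPolynomial (R := ℝ) E y]
        rfl
      rw [heq]
      exact MvPolynomial.continuous_eval _
    exact h1.comp (Continuous.finSnoc (A := fun _ => ℝ) continuous_id continuous_const)
  exact (hcont.measurable.pow_const 2).const_div 1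

/-- **Discharge of `graphPeriod_convergent_of_isPrimitiveDivergent`** (Brown 2009, §3.1; Bloch–
Esnault–Kreimer 2006, Prop. 5.2): for a connected primitive-divergent edge list, `Ψ_E(x,1) > 0` on
the open orthant and `∫_{x>0} dx/Ψ_E(x,1)²` converges absolutely. Proof by the Hepp bound
(`heppBound`) and domination by a product of one-variable integrable majorants
(`graphPeriodIntegrand_le_prod_heppMajorant`, `Integrable.fintype_prod`).
[cite: Brown2009FeynmanPeriods, §3.1 (convergence and positivity of I_G for primitive divergent G)] -/
theorem graphPeriod_convergent_of_isPrimitiveDivergent_holds :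
    graphPeriod_convergent_of_isPrimitiveDivergent := by
  intro n V E hc hp
  refine ⟨fun x hx => (heppBound E hc hp _ (snoc_pos hx) 0 0).2, ?_⟩
  have hn : n ≠ 0 := by
    rintro rfl
    have h1 := hp.1
    omega
  have hδ0 : 0 < ((n : ℝ)⁻¹) := inv_pos.mpr (Nat.cast_pos.mpr (Nat.pos_of_ne_zero hn))
  have hset : openOrthant n = Set.univ.pi fun _ : Fin n => Set.Ioi (0 : ℝ) := by
    ext x
    simp [openOrthant]
  have hmeas : MeasurableSet (openOrthant n) := by
    rw [hset]
    exact MeasurableSet.univ_pi fun _ => measurableSet_Ioi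
  have hG : Integrable (fun x : Fin n → ℝ => ∏ k, ((x k)⁻¹ * (min (x k) (x k)⁻¹) ^ ((n : ℝ)⁻¹)))
      ((volume : Measure (Fin n → ℝ)).restrict (openOrthant n)) := by
    rw [hset, volume_pi, Measure.restrict_pi_pi]
    exact Integrable.fintype_prod
      (f := fun (_ : Fin n) (t : ℝ) => t⁻¹ * (min t t⁻¹) ^ ((n : ℝ)⁻¹))
      fun _ => integrableOn_heppMajorant hδ0
  refine hG.mono' (measurable_graphPeriodIntegrand E).aestronglyMeasurable
    (ae_restrict_of_forall_mem hmeas fun x hx => ?_)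
  rw [Real.norm_of_nonneg (by unfold graphPeriodIntegrand; positivity)]
  exact graphPeriodIntegrand_le_prod_heppMajorant hn E hc hp x hx

end Integrability

end Literature.MathematicalPhysics.QuantumFieldTheory
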